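import Mathlib
import Summits.Ventures.PercRepro2.HCov
import Summits.Ventures.PercRepro2.HCovCard5
import Summits.Ventures.PercRepro2.PMK5Deg5K6
import Summits.Ventures.PercRepro2.BlockSubstLaw

/-!
# THEOREM 32: (HCOV) on every graph with at most six terminals, and on every graph with five
terminals (blind cell PercRepro2, mine-2 g33)

A graph has **at most six terminals** when its edges split into mark-free two-terminal blocks on
a skeleton `K₆` (`Deg5.ends15`, the marks at `o = 0, a₁ = 1, a₂ = 2, a₃ = 5, b = 4`, one unmarked
terminal `u = 3`; an empty block is a missing skeleton edge) — `IsBlockSubst ends Deg5.ends15 q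
blk Vj`: every edge of `K₆` replaced by an arbitrary mark-free two-terminal network, the number of
vertices arbitrary.  By `BlockSubst.HCov_of_skeleton` the covariance form of such a graph is the
covariance form of `K₆` at the block weights, and THEOREM 30 (`Deg5.HCov_k6`: (HCOV) on `K₆` for
every weight vector) decides:

* **`HCov_sixTerminal`** — (HCOV) on every graph with at most six terminals, every admissible
  weight vector; `ZDelta_sixTerminal` the crux of record under `P(a₁ ↔ b) ≤ P(a₂ ↔ b)`;
* **`HCov_fiveTerminal`** — (HCOV) on every graph whose edges split into mark-free two-terminal
  blocks on a loop-free skeleton without parallel edges on five terminals, the five marks the five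
  terminals in any order (the `K₅` theorem `K5.HCov_card5`); typer-1 g48's necklaces and cycles are
  the skeleton `C₅`.

The graphs with all fifteen `K₆`-blocks nontrivial lie outside the typed rungs of the cell (the
reduced core keeps fifteen typed edges); the theorem is THEOREM 30 carried to arbitrary `n` by the
block-substitution invariance of `BlockSubstLaw.lean`.  Standard axioms only.
-/

namespace Summit.Ventures.PercRepro2

namespace BlockSubst

section SixTerminal

variable {V : Type*} {E : Type*} [Fintype E] [DecidableEq E] {R : Type*} [Field R]
  [LinearOrder R] [IsStrictOrderedRing R]

/-- **THEOREM 32 — (HCOV) on every graph with at most six terminals**: the edges split into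
mark-free two-terminal blocks on the skeleton `K₆` (`Deg5.ends15`; an empty block is a missing
edge), the marks at the terminals `o = q 0, a₁ = q 1, a₂ = q 2, a₃ = q 5, b = q 4` and `q 3` the
unmarked terminal; every admissible weight vector.  The block weights are admissible, so
THEOREM 30 (`Deg5.HCov_k6`) applies to the skeleton, and (HCOV) descends (`HCov_of_skeleton`). -/
theorem HCov_sixTerminal {ends : E → Sym2 V} {q : Fin 6 → V} {blk : E → Fin 15}
    {Vj : Fin 15 → Set V} (hB : IsBlockSubst ends Deg5.ends15 q blk Vj) (p : E → R)
    (hp : IsProbVec p) : CovForm.HCov p ends (q 0) (q 1) (q 2) (q 5) (q 4) :=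
  HCov_of_skeleton hB 0 1 2 5 4 (fun r hr => Deg5.HCov_k6 r hr) p hp

/-- **The crux of record on every graph with at most six terminals** under
`P(a₁ ↔ b) ≤ P(a₂ ↔ b)`. -/
theorem ZDelta_sixTerminal [Fintype V] [DecidableEq V] {ends : E → Sym2 V} {q : Fin 6 → V}
    {blk : E → Fin 15} {Vj : Fin 15 → Set V} (hB : IsBlockSubst ends Deg5.ends15 q blk Vj)
    (p : E → R) (hp : IsProbVec p)
    (hord : prob p (connEvent ends (q 1) (q 4)) ≤ prob p (connEvent ends (q 2) (q 4))) :
    ZDelta p ends (q 0) (q 1) (q 2) (q 5) (q 4) :=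
  ZDelta_blockSubst hB 0 1 2 5 4 (fun r hr => Deg5.HCov_k6 r hr) p hp hord

end SixTerminal

section FiveTerminal

variable {V : Type*} {E : Type*} {V' : Type*} {E' : Type*} [Fintype E] [DecidableEq E]
  [Fintype V'] [DecidableEq V'] [Fintype E'] [DecidableEq E'] {R : Type*} [Field R]
  [LinearOrder R] [IsStrictOrderedRing R]

/-- **(HCOV) on every graph with five terminals**: the edges split into mark-free two-terminal
blocks on a loop-free skeleton without parallel edges on exactly five terminals, the five marks
the five terminals in any order, every admissible weight vector (`K5.HCov_card5` on the skeleton,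
`HCov_of_skeleton`). -/
theorem HCov_fiveTerminal {ends : E → Sym2 V} {ends' : E' → Sym2 V'} {q : V' → V} {blk : E → E'}
    {Vj : E' → Set V} (hB : IsBlockSubst ends ends' q blk Vj) (hV' : Fintype.card V' = 5)
    (hloop : ∀ j, ¬ (ends' j).IsDiag) (hinj : Function.Injective ends') (o a₁ a₂ a₃ b : V')
    (h01 : o ≠ a₁) (h02 : o ≠ a₂) (h03 : o ≠ a₃) (h04 : o ≠ b) (h12 : a₁ ≠ a₂) (h13 : a₁ ≠ a₃)
    (h14 : a₁ ≠ b) (h23 : a₂ ≠ a₃) (h24 : a₂ ≠ b) (h34 : a₃ ≠ b) (p : E → R) (hp : IsProbVec p) :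
    CovForm.HCov p ends (q o) (q a₁) (q a₂) (q a₃) (q b) :=
  HCov_of_skeleton hB o a₁ a₂ a₃ b
    (fun r hr => K5.HCov_card5 hV' ends' hloop hinj o a₁ a₂ a₃ b h01 h02 h03 h04 h12 h13 h14 h23
      h24 h34 r hr) p hp

end FiveTerminal

section Card6

variable {V : Type*} {E : Type*} [Fintype V] [DecidableEq V] [Fintype E] [DecidableEq E]
  {R : Type*} [Field R] [LinearOrder R] [IsStrictOrderedRing R]

/-- The index of the `K₆`-edge `{a, b}` in `Deg5.ends15` (the diagonal is sent to `0`). -/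
def idx6 (a b : Fin 6) : Fin 15 :=
  ![![0, 0, 1, 2, 3, 10], ![0, 0, 4, 5, 6, 11], ![1, 4, 0, 7, 8, 12], ![2, 5, 7, 0, 9, 13],
    ![3, 6, 8, 9, 0, 14], ![10, 11, 12, 13, 14, 0]] a b

/-- `idx6` is the index of the edge `{a, b}`. -/
lemma ends15_idx6 : ∀ a b : Fin 6, a ≠ b → Deg5.ends15 (idx6 a b) = s(a, b) := by
  decide

/-- `idx6` is symmetric. -/
lemma idx6_comm : ∀ a b : Fin 6, idx6 a b = idx6 b a := by
  decide

omit [DecidableEq V] in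
/-- Six distinct elements of a six-element type are the images of `0, …, 5` under some bijection
from `Fin 6`, in the order `(o, a₁, a₂, u, b, a₃)` of `Deg5.ends15`. -/
lemma exists_bijective_of_six (hV : Fintype.card V = 6) (o a₁ a₂ a₃ b u : V) (h01 : o ≠ a₁)
    (h02 : o ≠ a₂) (h03 : o ≠ a₃) (h04 : o ≠ b) (h12 : a₁ ≠ a₂) (h13 : a₁ ≠ a₃) (h14 : a₁ ≠ b)
    (h23 : a₂ ≠ a₃) (h24 : a₂ ≠ b) (h34 : a₃ ≠ b) (hu0 : u ≠ o) (hu1 : u ≠ a₁) (hu2 : u ≠ a₂)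
    (hu3 : u ≠ a₃) (hu4 : u ≠ b) :
    Function.Bijective (![o, a₁, a₂, u, b, a₃] : Fin 6 → V) := by
  have hf : Function.Injective (![o, a₁, a₂, u, b, a₃] : Fin 6 → V) := by
    intro i j hij
    fin_cases i <;> fin_cases j <;> simp at hij ⊢ <;>
      first
      | exact absurd hij h01 | exact absurd hij.symm h01
      | exact absurd hij h02 | exact absurd hij.symm h02
      | exact absurd hij h03 | exact absurd hij.symm h03
      | exact absurd hij h04 | exact absurd hij.symm h04
      | exact absurd hij h12 | exact absurd hij.symm h12
      | exact absurd hij h13 | exact absurd hij.symm h13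
      | exact absurd hij h14 | exact absurd hij.symm h14
      | exact absurd hij h23 | exact absurd hij.symm h23
      | exact absurd hij h24 | exact absurd hij.symm h24
      | exact absurd hij h34 | exact absurd hij.symm h34
      | exact absurd hij hu0 | exact absurd hij.symm hu0
      | exact absurd hij hu1 | exact absurd hij.symm hu1
      | exact absurd hij hu2 | exact absurd hij.symm hu2
      | exact absurd hij hu3 | exact absurd hij.symm hu3
      | exact absurd hij hu4 | exact absurd hij.symm hu4
  exact (Fintype.bijective_iff_injective_and_card _).2 ⟨hf, by simp [hV]⟩

/-- A six-element type has an element outside five given ones. -/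
lemma exists_sixth (hV : Fintype.card V = 6) (o a₁ a₂ a₃ b : V) :
    ∃ u, u ≠ o ∧ u ≠ a₁ ∧ u ≠ a₂ ∧ u ≠ a₃ ∧ u ≠ b := by
  by_contra h
  have hsub : (Finset.univ : Finset V) ⊆ {o, a₁, a₂, a₃, b} := by
    intro u _
    by_contra hu
    simp only [Finset.mem_insert, Finset.mem_singleton, not_or] at hu
    exact h ⟨u, hu.1, hu.2.1, hu.2.2.1, hu.2.2.2.1, hu.2.2.2.2⟩
  have := (Finset.card_le_card hsub).trans Finset.card_le_five
  rw [Finset.card_univ, hV] at this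
  omega

/-- **THEOREM 30 on every six-vertex marked graph, any edge type, any labelling**: (HCOV) on
every loop-free graph (parallel edges allowed) on exactly six vertices, for every choice of five
distinct marks and every admissible weight vector — every edge is its own block of the skeleton
`K₆` (`HCov_sixTerminal`). -/
theorem HCov_card6 (hV : Fintype.card V = 6) (ends : E → Sym2 V)
    (hloop : ∀ e, ¬ (ends e).IsDiag) (o a₁ a₂ a₃ b : V) (h01 : o ≠ a₁) (h02 : o ≠ a₂)
    (h03 : o ≠ a₃) (h04 : o ≠ b) (h12 : a₁ ≠ a₂) (h13 : a₁ ≠ a₃) (h14 : a₁ ≠ b) (h23 : a₂ ≠ a₃)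
    (h24 : a₂ ≠ b) (h34 : a₃ ≠ b) (p : E → R) (hp : IsProbVec p) :
    CovForm.HCov p ends o a₁ a₂ a₃ b := by
  obtain ⟨u, hu0, hu1, hu2, hu3, hu4⟩ := exists_sixth hV o a₁ a₂ a₃ b
  set q : Fin 6 → V := ![o, a₁, a₂, u, b, a₃] with hq
  have hbij : Function.Bijective q :=
    exists_bijective_of_six hV o a₁ a₂ a₃ b u h01 h02 h03 h04 h12 h13 h14 h23 h24 h34 hu0 hu1
      hu2 hu3 hu4
  let ι : V ≃ Fin 6 := (Equiv.ofBijective q hbij).symm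
  have hqι : ∀ x, q (ι x) = x := fun x => Equiv.ofBijective_apply_symm_apply q hbij x
  -- the block of an edge: the index of its image in `K₆`
  let blk : E → Fin 15 := fun e =>
    Sym2.lift ⟨fun x y => idx6 (ι x) (ι y), fun x y => idx6_comm (ι x) (ι y)⟩ (ends e)
  -- the vertex set of a block: its two terminals
  let Vj : Fin 15 → Set V := fun j => {x | ∃ k ∈ Deg5.ends15 j, x = q k}
  have hB : IsBlockSubst ends Deg5.ends15 q blk Vj := by
    refine ⟨?_, ?_, ?_, ?_, hbij.1⟩
    · intro e x hx
      have hne := hloop e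
      revert hx hne
      simp only [blk]
      induction ends e using Sym2.ind with
      | h x₀ y₀ =>
        intro hx hne
        rw [Sym2.mk_isDiag_iff] at hne
        rw [Sym2.lift_mk]
        have hι : ι x₀ ≠ ι y₀ := fun h => hne (ι.injective h)
        show ∃ k ∈ Deg5.ends15 (idx6 (ι x₀) (ι y₀)), x = q k
        rw [ends15_idx6 _ _ hι]
        rw [Sym2.mem_iff] at hx
        rcases hx with rfl | rfl
        · exact ⟨ι _, Sym2.mem_mk_left _ _, (hqι _).symm⟩
        · exact ⟨ι _, Sym2.mem_mk_right _ _, (hqι _).symm⟩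
    · intro j k hk
      exact ⟨k, hk, rfl⟩
    · intro j j' _ x hx _
      exact hx
    · intro j k hk
      obtain ⟨k', hk', hkk'⟩ := hk
      rw [hbij.1 hkk']
      exact hk'
  exact HCov_sixTerminal hB p hp

end Card6

end BlockSubst

end Summit.Ventures.PercRepro2
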